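import Summits.PneNP.PneNP.Theses.ORIncompressibility
import Literature.Computability.Complexity.CliqueSqrtLowerBound
import Literature.Computability.Complexity.NegationElimination
import Literature.Computability.Complexity.CircuitComposition
import Literature.Computability.Complexity.CircuitClassesProofs
import Literature.Computability.Complexity.CircuitLowerBoundsProofs
import Literature.Computability.Complexity.CliqueTestGraphs

/-!
# Route ORIncompressibility — `NoMonotoneCompressionClique` (stmt-PneNP-13975)

Monotone OR-incompressibility of CLIQUE tuples at the exact Fortnow–Santhanam budget: for
`t ≤ v^k` blocks (graphs on `v` vertices, as edge-indicator vectors over `KEdge v`) and ANY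
`m < t`, no family of `m` circuits over `monotoneBasis = {∧₂, ∨₂}` of size `≤ (t·v)^k` each has
fibres pure for `[∃ i, block i has a ⌊√v⌋-clique]`.

## Proof (block saturation + Razborov / Alon–Boppana)

Write `s = ⌊√v⌋`, `f_j = (C j).eval` (monotone) and `On(u) = {j | f_j(u) = 1}` for a tuple `u` of
`t` graphs. Let `M_q` be the maximum of `|On(u)|` over the CLIQUE-FREE tuples `u` (no block has an
`s`-clique) with at most `q` nonempty blocks (the all-empty tuple qualifies once `s ≥ 2`).
`M_0 ≤ M_1 ≤ ⋯ ≤ M_{m+1} ≤ m`, so `M_q = M_{q+1}` for some `q ≤ m < t`. A maximiser `u` has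
`≤ q < t` nonempty blocks, hence an empty block `r`. For a graph `G` put `u[r:=G]`.
* If `G` is clique-free then `u ≤ u[r:=G]` is clique-free with `≤ q+1` nonempty blocks, so
  `On(u) ⊆ On(u[r:=G])` (monotonicity) and `|On(u[r:=G])| ≤ M_{q+1} = |On(u)|`: no output changes.
* If `G` has an `s`-clique then the block-OR flips from `0` to `1`, so purity (the negated
  conclusion) and monotonicity force some `j ∉ On(u)` to switch on.
Hence `g(G) := ⋁_{j ∉ On(u)} f_j(u[r:=G])` is EXACTLY `CLIQUE(v, s)`, and it is computed by a
circuit over `{∧₂, ∨₂, 0, 1}` with `2 + m·(t v)^k + m ≤ 4 v^{k²+2k}` gates (two constant gates feed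
the frozen blocks). Constant elimination (`GateList.const_or_exists_monotone_circuit`) turns it
into a `{∧₂, ∨₂}`-circuit of no larger size computing `CLIQUE(v, ⌊√v⌋)` (the function is not
constant), contradicting the `2^{v^{1/8}}` lower bound `cliqueSqrt_monotone_lowerBound`
(Razborov 1985; Alon–Boppana 1987; Tardos 1988) for large `v`.

References: L. Fortnow, R. Santhanam, *Infeasibility of instance compression and succinct PCPs
for NP*, JCSS 77 (2011) (the OR-compression budget); S. Jukna, *On the minimum number of
negations leading to super-polynomial savings*, IPL 89 (2004) (block restrictions); A. A.
Razborov (1985), N. Alon – R. Boppana (1987), É. Tardos (1988) (the monotone clique bound, tree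
theorem `cliqueSqrt_monotone_lowerBound`).
-/

set_option linter.dupNamespace false -- `Summit.PneNP.PneNP.…`: summit = sub-problem name (D-0017 single-conjunct layout)

namespace Summit.PneNP.PneNP.Theorems

open Finset Filter
open Literature.Computability.Complexity

/-! ### Two elementary lemmas -/

/-- Polynomials are eventually below `2^{v^{1/8}}`: for every `d` and `A`,
`A · v^d < 2^{v^{1/8}}` for all large `v : ℕ`. [folklore] -/
theorem eventually_mul_pow_lt_two_rpow_eighth (d : ℕ) (A : ℝ) :
    ∀ᶠ v : ℕ in atTop, A * (v : ℝ) ^ d < (2 : ℝ) ^ ((v : ℝ) ^ (1 / 8 : ℝ)) := by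
  have h1 : (fun x : ℝ => x ^ (8 * d)) =o[atTop] fun x => Real.exp (Real.log 2 * x) :=
    isLittleO_pow_exp_pos_mul_atTop (8 * d) (Real.log_pos one_lt_two)
  have h2 := h1.comp_tendsto (tendsto_rpow_atTop (by norm_num : (0 : ℝ) < 1 / 8))
  have h3 := h2.comp_tendsto tendsto_natCast_atTop_atTop
  have hc : (0 : ℝ) < 1 / (|A| + 1) := by positivity
  filter_upwards [h3.def hc] with v hv
  simp only [Function.comp_def] at hv
  have hv0 : (0 : ℝ) ≤ v := Nat.cast_nonneg v
  have hpow : ((v : ℝ) ^ (1 / 8 : ℝ)) ^ (8 * d) = (v : ℝ) ^ d := by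
    rw [← Real.rpow_natCast, ← Real.rpow_mul hv0, ← Real.rpow_natCast]
    congr 1
    push_cast
    ring
  have hexp : Real.exp (Real.log 2 * (v : ℝ) ^ (1 / 8 : ℝ)) = (2 : ℝ) ^ ((v : ℝ) ^ (1 / 8 : ℝ)) := by
    rw [Real.rpow_def_of_pos two_pos]
  rw [Real.norm_of_nonneg (by positivity), Real.norm_of_nonneg (Real.exp_pos _).le, hpow,
    hexp] at hv
  have h2pos : (0 : ℝ) < (2 : ℝ) ^ ((v : ℝ) ^ (1 / 8 : ℝ)) := by positivity
  have hA : |A| * (1 / (|A| + 1)) < 1 := by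
    rw [mul_one_div, div_lt_one (by positivity)]
    linarith
  calc A * (v : ℝ) ^ d ≤ |A| * (v : ℝ) ^ d :=
        mul_le_mul_of_nonneg_right (le_abs_self A) (by positivity)
    _ ≤ |A| * (1 / (|A| + 1) * (2 : ℝ) ^ ((v : ℝ) ^ (1 / 8 : ℝ))) :=
        mul_le_mul_of_nonneg_left hv (abs_nonneg A)
    _ = |A| * (1 / (|A| + 1)) * (2 : ℝ) ^ ((v : ℝ) ^ (1 / 8 : ℝ)) := by ring
    _ < 1 * (2 : ℝ) ^ ((v : ℝ) ^ (1 / 8 : ℝ)) := mul_lt_mul_of_pos_right hA h2pos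
    _ = (2 : ℝ) ^ ((v : ℝ) ^ (1 / 8 : ℝ)) := one_mul _

/-- Pigeonhole for a monotone sequence: if `f (m+1) ≤ m` then `f q = f (q+1)` for some `q ≤ m`.
[folklore] -/
theorem exists_le_apply_eq_apply_succ {f : ℕ → ℕ} (hf : Monotone f) {m : ℕ} (hm : f (m + 1) ≤ m) :
    ∃ q ≤ m, f q = f (q + 1) := by
  by_contra h
  push Not at h
  have key : ∀ q ≤ m + 1, q ≤ f q := by
    intro q
    induction q with
    | zero => exact fun _ => Nat.zero_le _
    | succ q ih =>
      intro hq
      have h1 := ih (by omega)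
      have h2 : f q < f (q + 1) := lt_of_le_of_ne (hf (Nat.le_succ q)) (h q (by omega))
      omega
  have := key (m + 1) le_rfl
  omega

/-! ### The theorem -/

/-- **Monotone OR-incompressibility of CLIQUE tuples** (route ORIncompressibility, support item
stmt-PneNP-13975 `NoMonotoneCompressionClique`): for every `k`, for all large `v`, for all
`m < t ≤ v^k` and all families of `m` circuits over `{∧₂, ∨₂}` on `t` blocks of edge variables
`KEdge v`, each of size `≤ (t v)^k`, there are two inputs with the same `m` output bits but
different values of `⋁_i CLIQUE(v, ⌊√v⌋)(block i)`. Proof: block saturation (module docstring),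
constant elimination, and the Razborov / Alon–Boppana / Tardos bound
`cliqueSqrt_monotone_lowerBound`. [cite: FortnowSanthanam2011, §1] [cite: Tardos1988, p. 141 (Corollary)] -/
theorem orIncompressibility_noMonotoneCompressionClique_proof :
    Summit.PneNP.PneNP.Theses.ORIncompressibility.NoMonotoneCompressionClique := by
  unfold Summit.PneNP.PneNP.Theses.ORIncompressibility.NoMonotoneCompressionClique
  intro k
  classical
  -- thresholds: the lower bound, the polynomial/exponential comparison, and `⌊√v⌋ ≥ 2`
  obtain ⟨v₁, hv₁⟩ := eventually_atTop.1 (cliqueSqrt_monotone_lowerBound)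
  obtain ⟨v₂, hv₂⟩ := eventually_atTop.1 (eventually_mul_pow_lt_two_rpow_eighth (k * k + 2 * k) 4)
  refine ⟨max (max v₁ v₂) 4, fun v hv t m hmt htv C hC => ?_⟩
  have hvv₁ : v₁ ≤ v := le_trans (le_max_left _ _) (le_trans (le_max_left _ _) hv)
  have hvv₂ : v₂ ≤ v := le_trans (le_max_right _ _) (le_trans (le_max_left _ _) hv)
  have hv4 : 4 ≤ v := le_trans (le_max_right _ _) hv
  have hv1 : 1 ≤ v := by omega
  set s : ℕ := Nat.sqrt v with hs_def
  have hs2 : 2 ≤ s := by rw [hs_def, Nat.le_sqrt]; omega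
  have hsv : s ≤ v := Nat.sqrt_le_self v
  -- the two extreme graphs
  have hbot : cliqueFn v s (fun _ : KEdge v => false) = false := by
    rw [cliqueFn_eq_false_iff]
    have hG : cliqueGraph (m := v) (fun _ => false) = ⊥ := by
      ext a b
      simp [cliqueGraph_adj]
    rw [hG]
    exact SimpleGraph.cliqueFree_bot hs2
  have htop : cliqueFn v s (cliqueVec (Finset.univ : Finset (Fin v))) = true :=
    cliqueFn_cliqueVec (by simpa using hsv)
  -- negate the conclusion: the fibres are pure
  by_contra hpure
  push Not at hpure
  -- bookkeeping on tuples of graphs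
  set On : (Fin t × KEdge v → Bool) → Finset (Fin m) :=
    fun u => univ.filter fun j => (C j).eval u = true with hOn_def
  set NB : (Fin t × KEdge v → Bool) → Finset (Fin t) :=
    fun u => univ.filter fun i => ∃ e, u (i, e) = true with hNB_def
  set A : ℕ → Finset (Fin t × KEdge v → Bool) := fun q =>
    univ.filter fun u => (∀ i, cliqueFn v s (fun e => u (i, e)) = false) ∧ #(NB u) ≤ q
    with hA_def
  set M : ℕ → ℕ := fun q => (A q).sup fun u => #(On u) with hM_def
  have hmemA : ∀ q u, u ∈ A q ↔ (∀ i, cliqueFn v s (fun e => u (i, e)) = false) ∧ #(NB u) ≤ q := by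
    intro q u
    simp only [hA_def, mem_filter, mem_univ, true_and]
  have hmemOn : ∀ u j, j ∈ On u ↔ (C j).eval u = true := by
    intro u j
    simp only [hOn_def, mem_filter, mem_univ, true_and]
  have hmemNB : ∀ u i, i ∈ NB u ↔ ∃ e, u (i, e) = true := by
    intro u i
    simp only [hNB_def, mem_filter, mem_univ, true_and]
  -- the all-empty tuple is clique-free with no nonempty block
  have h0A : ∀ q, (fun _ : Fin t × KEdge v => false) ∈ A q := by
    intro q
    rw [hmemA]
    refine ⟨fun i => hbot, ?_⟩
    have hNB0 : NB (fun _ => false) = ∅ := by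
      ext i
      simp [hmemNB]
    rw [hNB0, card_empty]
    exact Nat.zero_le _
  have hAne : ∀ q, (A q).Nonempty := fun q => ⟨_, h0A q⟩
  -- `M` is monotone and bounded by `m`
  have hMmono : Monotone M := by
    refine monotone_nat_of_le_succ fun q => ?_
    refine Finset.sup_mono fun u hu => ?_
    rw [hmemA] at hu ⊢
    exact ⟨hu.1, hu.2.trans (Nat.le_succ q)⟩
  have hMle : ∀ q, M q ≤ m := by
    intro q
    refine Finset.sup_le fun u _ => ?_
    exact (card_le_univ (On u)).trans (by simp)
  -- saturation: `M q = M (q+1)` for some `q ≤ m`, a maximiser `u`, an empty block `r`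
  obtain ⟨q, hqm, hq⟩ := exists_le_apply_eq_apply_succ hMmono (hMle (m + 1))
  obtain ⟨u, huA, huM⟩ := Finset.exists_mem_eq_sup (A q) (hAne q) fun u => #(On u)
  obtain ⟨huCF, huNB⟩ := (hmemA q u).1 huA
  obtain ⟨r, hr⟩ : ∃ r : Fin t, r ∉ NB u := by
    by_contra hall
    push Not at hall
    have hNBu : NB u = univ := eq_univ_iff_forall.2 hall
    have : #(NB u) = t := by rw [hNBu, card_univ, Fintype.card_fin]
    omega
  have hur : ∀ e, u (r, e) = false := by
    intro e
    by_contra he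
    exact hr ((hmemNB u r).2 ⟨e, by simpa using he⟩)
  -- replacing block `r` by a graph `G`
  set subst : (KEdge v → Bool) → (Fin t × KEdge v → Bool) :=
    fun G p => if p.1 = r then G p.2 else u p with hsubst_def
  have hsubst_r : ∀ G, (fun e => subst G (r, e)) = G := by
    intro G
    funext e
    simp [hsubst_def]
  have hsubst_ne : ∀ G i, i ≠ r → (fun e => subst G (i, e)) = fun e => u (i, e) := by
    intro G i hi
    funext e
    simp [hsubst_def, hi]
  have hle : ∀ G, u ≤ subst G := by
    intro G p
    by_cases hp : p.1 = r
    · have : u p = false := by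
        obtain ⟨i, e⟩ := p
        simp only at hp
        subst hp
        exact hur e
      rw [this]
      exact Bool.false_le _
    · simp [hsubst_def, hp]
  have hmono : ∀ G j, (C j).eval u = true → (C j).eval (subst G) = true := fun G j h =>
    Bool.le_iff_imp.1 ((C j).monotone_eval_of_isOver_monotoneBasis (hC j).1 (hle G)) h
  -- (a) a clique-free `G` changes no output
  have hsat : ∀ G, cliqueFn v s G = false → ∀ j, (C j).eval (subst G) = (C j).eval u := by
    intro G hG
    have hA1 : subst G ∈ A (q + 1) := by
      rw [hmemA]
      constructor
      · intro i
        by_cases hi : i = r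
        · subst hi
          rw [hsubst_r]
          exact hG
        · rw [hsubst_ne G i hi]
          exact huCF i
      · have hsub : NB (subst G) ⊆ insert r (NB u) := by
          intro i hi
          rw [hmemNB] at hi
          obtain ⟨e, he⟩ := hi
          by_cases hir : i = r
          · subst hir
            exact mem_insert_self _ _
          · refine mem_insert_of_mem ((hmemNB u i).2 ⟨e, ?_⟩)
            simpa [hsubst_def, hir] using he
        exact (card_le_card hsub).trans ((card_insert_le _ _).trans (by omega))
    have hcard : #(On (subst G)) ≤ #(On u) := by
      have h1 : #(On (subst G)) ≤ M (q + 1) := Finset.le_sup (f := fun u => #(On u)) hA1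
      rw [← hq] at h1
      exact h1.trans (le_of_eq huM)
    have hsub : On u ⊆ On (subst G) := by
      intro j hj
      rw [hmemOn] at hj ⊢
      exact hmono G j hj
    have hEq : On u = On (subst G) := eq_of_subset_of_card_le hsub hcard
    intro j
    rw [Bool.eq_iff_iff, ← hmemOn, ← hmemOn, hEq]
  -- (b) a graph with an `s`-clique switches some off-output on
  have hswitch : ∀ G, cliqueFn v s G = true →
      ∃ j, (C j).eval u = false ∧ (C j).eval (subst G) = true := by
    intro G hG
    by_contra hno
    push Not at hno
    have hsame : ∀ j, (C j).eval u = (C j).eval (subst G) := by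
      intro j
      cases hju : (C j).eval u
      · by_contra h2
        exact hno j hju (by simpa using Ne.symm h2)
      · exact (hmono G j hju).symm
    have hiff := hpure u (subst G) hsame
    have hright : ∃ i : Fin t, cliqueFn v s (fun e => subst G (i, e)) = true :=
      ⟨r, by rw [hsubst_r]; exact hG⟩
    obtain ⟨i, hi⟩ := hiff.2 hright
    rw [huCF i] at hi
    exact Bool.false_ne_true hi
  -- the off-outputs
  set offList : List (Fin m) := (univ.filter fun j : Fin m => (C j).eval u = false).toList
    with hoff_def
  have hmem_off : ∀ j, j ∈ offList ↔ (C j).eval u = false := by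
    intro j
    simp only [hoff_def, mem_toList, mem_filter, mem_univ, true_and]
  have hoff_ne : offList ≠ [] := by
    obtain ⟨j, hj, -⟩ := hswitch _ htop
    intro hnil
    have : j ∈ offList := (hmem_off j).2 hj
    rw [hnil] at this
    simp at this
  have hoff_len : offList.length ≤ m := by
    rw [hoff_def, length_toList]
    exact (card_le_univ _).trans (by simp)
  -- `g(G) := ⋁_{j off} f_j(u[r:=G])` is exactly `CLIQUE(v, s)`
  have hg : ∀ G, (offList.any fun j => (C j).eval (subst G)) = cliqueFn v s G := by
    intro G
    cases hG : cliqueFn v s G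
    · rw [List.any_eq_false]
      intro j hj
      rw [hsat G hG j, (hmem_off j).1 hj]
      exact Bool.false_ne_true
    · rw [List.any_eq_true]
      obtain ⟨j, hju, hjG⟩ := hswitch G hG
      exact ⟨j, (hmem_off j).2 hju, hjG⟩
  -- a circuit over `{∧₂, ∨₂, 0, 1}` for `g`
  have hct : GateFn.const true ∈ monotoneBasis01 := Set.mem_insert _ _
  have hcf : GateFn.const false ∈ monotoneBasis01 := Set.mem_insert_of_mem _ (Set.mem_insert _ _)
  have hT : CktSize monotoneBasis01 (fun (_ : KEdge v → Bool) (_ : Unit) => true) 1 :=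
    (CktSize.gate (B := monotoneBasis01) (ι := KEdge v) (GateFn.const true) hct Fin.elim0).congr
      fun _ _ => rfl
  have hF : CktSize monotoneBasis01 (fun (_ : KEdge v → Bool) (_ : Unit) => false) 1 :=
    (CktSize.gate (B := monotoneBasis01) (ι := KEdge v) (GateFn.const false) hcf Fin.elim0).congr
      fun _ _ => rfl
  have h0 : CktSize monotoneBasis01 (fun (G : KEdge v → Bool) =>
      Sum.elim G (Sum.elim (fun _ : Unit => true) (fun _ : Unit => false))) (0 + (1 + 1)) :=
    (CktSize.id monotoneBasis01).pair (hT.pair hF)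
  set ρ : Fin t × KEdge v → KEdge v ⊕ (Unit ⊕ Unit) := fun p =>
    if p.1 = r then Sum.inl p.2 else if u p = true then Sum.inr (Sum.inl ()) else Sum.inr (Sum.inr ())
    with hρ_def
  have hstageA : CktSize monotoneBasis01 (fun (G : KEdge v → Bool) (p : Fin t × KEdge v) =>
      subst G p) (0 + (1 + 1) + 0) := by
    refine (h0.comp (CktSize.proj monotoneBasis01 ρ)).congr fun G p => ?_
    by_cases hp : p.1 = r
    · simp [hρ_def, hsubst_def, hp]
    · by_cases hup : u p = true
      · simp [hρ_def, hsubst_def, hp, hup]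
      · have hup' : u p = false := by simpa using hup
        simp [hρ_def, hsubst_def, hp, hup']
  have hstageB : CktSize monotoneBasis01 (fun (y : Fin t × KEdge v → Bool) (j : Fin m) =>
      (C j).eval y) (Fintype.card (Fin m) * (t * v) ^ k) :=
    CktSize.pi_const fun j =>
      (((C j).cktSize_eval (hC j).1).basis_mono monotoneBasis_subset_monotoneBasis01).of_le
        (hC j).2
  have hstageC : CktSize monotoneBasis01 (fun (z : Fin m → Bool) (_ : Unit) =>
      offList.any fun j => z j) offList.length :=
    (cktSize_any offList hoff_ne).basis_mono monotoneBasis_subset_monotoneBasis01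
  have hD := ((hstageA.comp hstageB).comp hstageC).congr fun G _ => hg G
  obtain ⟨D, hDB, hDsize, hDev⟩ := hD.toCircuit
  rw [Fintype.card_fin] at hDsize
  -- size bookkeeping: `|D| ≤ 2 + m (t v)^k + m ≤ 4 v^{k²+2k} < 2^{v^{1/8}}`
  have hsizeN : D.size ≤ 4 * v ^ (k * k + 2 * k) := by
    have hm : m ≤ v ^ k := by omega
    have h1 : (t * v) ^ k ≤ v ^ ((k + 1) * k) := by
      calc (t * v) ^ k ≤ (v ^ k * v) ^ k := Nat.pow_le_pow_left (Nat.mul_le_mul_right v htv) k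
        _ = v ^ ((k + 1) * k) := by rw [← pow_succ, ← pow_mul]
    have h2 : m * (t * v) ^ k ≤ v ^ (k * k + 2 * k) := by
      calc m * (t * v) ^ k ≤ v ^ k * v ^ ((k + 1) * k) := Nat.mul_le_mul hm h1
        _ = v ^ (k * k + 2 * k) := by rw [← pow_add]; congr 1; ring
    have h3 : m ≤ v ^ (k * k + 2 * k) :=
      hm.trans (Nat.pow_le_pow_right hv1 (by nlinarith))
    have h4 : 1 ≤ v ^ (k * k + 2 * k) := Nat.one_le_pow _ _ hv1
    have h5 : offList.length ≤ v ^ (k * k + 2 * k) := hoff_len.trans h3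
    calc D.size ≤ 0 + (1 + 1) + 0 + m * (t * v) ^ k + offList.length := hDsize
      _ ≤ 4 * v ^ (k * k + 2 * k) := by omega
  have hsizeR : (D.size : ℝ) < (2 : ℝ) ^ ((v : ℝ) ^ (1 / 8 : ℝ)) := by
    calc (D.size : ℝ) ≤ 4 * (v : ℝ) ^ (k * k + 2 * k) := by exact_mod_cast hsizeN
      _ < (2 : ℝ) ^ ((v : ℝ) ^ (1 / 8 : ℝ)) := hv₂ v hvv₂
  -- constant elimination, then the monotone lower bound
  have hDev' : ∀ G, GateList.wireOf G (GateList.vals D.gates G) D.output = cliqueFn v s G := by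
    intro G
    rw [← GateList.circuit_eval, hDev G]
  rcases GateList.const_or_exists_monotone_circuit D.gates D.output (GateList.wf_gates D) hDB
      D.wf_output with ⟨b, hb⟩ | ⟨Mc, hMcB, hMcsize, hMcev⟩
  · have h1 := (hDev' (fun _ => false)).symm.trans (hb _)
    have h2 := (hDev' (cliqueVec (univ : Finset (Fin v)))).symm.trans (hb _)
    rw [hbot] at h1
    rw [htop] at h2
    exact Bool.false_ne_true (h1.trans h2.symm)
  · have hcomp : Mc.Computes (cliqueFn v s) := fun G => (hMcev G).trans (hDev' G)
    have hLB := hv₁ v hvv₁ (cliqueFn v s) (fun Z hZ => cliqueFn_cliqueVec hZ.ge)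
      (fun O => cliqueFn_colorVec O (by omega)) Mc hMcB hcomp
    have hMc : (Mc.size : ℝ) ≤ D.size := by exact_mod_cast hMcsize
    exact absurd (hLB.trans hMc) (not_le.2 hsizeR)

end Summit.PneNP.PneNP.Theorems
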